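/-
Origin: expansion seat `prover-pub-hodgecm-mc-sinst-1-g7-0`, handover #1231 2026-08-20T15:36Z md5 ed04f86c7063 (90 l., 3 theorems) NEW additive leaf, ns HodgeCM.Model.ArchSideTerm + HodgeCM.Model.SInstance; imports RUN-51 #1229 ThetaAdelicSideR2 only; drop-alone; the slot-0 invariance of μ♯♯ and of the pin R2 SROGT'CJ; NAME LIST: HodgeCM.Model.ArchSideTerm.muSharp₂₃_congr_slot0 · HodgeCM.Model.SInstance.SROGT'C_congr_μ · HodgeCM.Model.SInstance.SROGT'CJ_congr_slot0 (`HOME/mc/pub-hodgecm-mc-sinst-1-g7/stage/HodgeCM/Model/ThetaAdelicSideR2Slot0.lean`, md5 ed04f86c7063, 90 lines);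
landed by the gen-22 packager (p-g22) in gate run 55 as `HodgeCM/Model/ThetaAdelicSideR2Slot0.lean` (verbatim).
-/
/-
Origin: CONSTRUCTION seat `prover-pub-hodgecm-mc-sinst-1-g7-0` (unit pub-hodgecm-mc-sinst-1-g7, gen 7 of mc-sinst-1 — S-INSTANCE CONSTRUCTOR,
BINDER-OWNERS row 5 `S`), 2026-08-20.  KERNEL only: theorems; closure {propext, Classical.choice, Quot.sound}.  Additive leaf over #1229
`ThetaAdelicSideR2` (RUN 51); nothing of PerL ∕ QW8 is claimed; 0 records, 0 `def … : Prop`, nothing cited.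
-/
import Summits.HodgeConjecture.HodgeCM.Model.ThetaAdelicSideR2

/-!
# (J-μ₀) R2, S SIDE: the pin R2 depends on E's slot table `μ` ONLY THROUGH ITS SLOT-0 ENTRY — `SInstance.SROGT'CJ_congr_slot0`

glue-1's (O2) question (STATUS 2026-08-20T15:27:45Z) «confirm the μ-enters-only-via-slot-0 reading on your bytes», as KERNEL THEOREMS:

* `ArchSideTerm.muSharp₂₃_congr_slot0` : two slot tables with the same slot-0 entries have the SAME adapter `μ♯♯ = muSharp₂₃ μ`
  (as families, `@muSharp₂₃ @μ = @muSharp₂₃ @μ'`) — entries 1, 2, 3 of `μ♯♯ c` are `μ c 0 + slotDelta∗ c.D` (`muSharp₂₃_one/two/three`),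
  entry 0 is `μ c 0` (`muSharp₂₃_zero`);
* `SInstance.SROGT'C_congr_μ` : the generic-`μ` pin `SROGT'C` at equal tables (and any (J-μ) proof inputs) is the same pin;
* `SInstance.SROGT'CJ_congr_slot0` : **`(∀ c, μ c 0 = μ' c 0) → SROGT'CJ … μ V c = SROGT'CJ … μ' V c`** — the pin R2 with no PROVE input
  reads `μ` only at slot 0.  Since every occurrence of `μ` in the E-shaped leaves over this pin (#398J2W ≺ … ≺ #398J2HHTCG) is
  `ArchSideTerm.muSharp₂₃ @μ`, the first lemma transports their whole statements along `μ ↦ μ'` with equal slot 0 (`▸`).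
-/


set_option autoImplicit false

noncomputable section

open scoped Matrix Classical
open NumberField
open Literature.NumberTheory.Automorphic Literature.NumberTheory.Weil1964
open Literature.NumberTheory.GelbartRogawski1991.UnitaryDualPair
open HodgeCM.Adelic HodgeCM.PerL34

namespace HodgeCM.Model

namespace ArchSideTerm

/-- **two slot tables with the same slot-0 entries have the same adapter `μ♯♯`** (as a family). -/
theorem muSharp₂₃_congr_slot0 {μ μ' : ∀ {L : CMField}, SeesawCtx L → Fin 4 → NumberField.InfinitePlace (L : Type) → ℤ}
    (h : ∀ {L : CMField} (c : SeesawCtx L), μ c 0 = μ' c 0) :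
    @muSharp₂₃ @μ = @muSharp₂₃ @μ' := by
  funext L c k
  fin_cases k
  · simp only [Fin.zero_eta, muSharp₂₃_zero, h]
  · simp only [Fin.mk_one, muSharp₂₃_one, h]
  · simp only [Fin.reduceFinMk, muSharp₂₃_two, h]
  · simp only [Fin.reduceFinMk, muSharp₂₃_three, h]

end ArchSideTerm

namespace SInstance

open HodgeCM.Model.ArchSideTerm

variable
  (hGR : ∀ {L : CMField} {ι₁ : L →+* ℂ} (V : HermSpace3 L ι₁) (c : SeesawCtx L),
    (cmSplittingDatum (L : Type) finProdFinEquiv (frameD V) (frameD_real V) (frameD_ne V) (dW c.D) (dW_real c.D)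
      (dW_ne c.D)).CompatibleSplitting)
  (hGR₀ : ∀ {L : CMField} {ι₁ : L →+* ℂ} (V : HermSpace3 L ι₁) (c : SeesawCtx L),
    (cmSplittingDatum (L : Type) (e₁) (frameD V) (frameD_real V) (frameD_ne V) (lineVec (L : Type) (dW c.D 0))
      (fun _ => dW_real c.D 0) (fun _ => dW_ne c.D 0)).CompatibleSplitting)
  (hGR₁ : ∀ {L : CMField} {ι₁ : L →+* ℂ} (V : HermSpace3 L ι₁) (c : SeesawCtx L),
    (cmSplittingDatum (L : Type) (e₁) (frameD V) (frameD_real V) (frameD_ne V) (lineVec (L : Type) (dW c.D 1))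
      (fun _ => dW_real c.D 1) (fun _ => dW_ne c.D 1)).CompatibleSplitting)
  (hGR₂ : ∀ {L : CMField} {ι₁ : L →+* ℂ} (V : HermSpace3 L ι₁) (c : SeesawCtx L),
    (cmSplittingDatum (L : Type) (e₁) (frameD V) (frameD_real V) (frameD_ne V) (lineVec (L : Type) (dW' c.D 0))
      (fun _ => dW'_real c.D 0) (fun _ => dW'_ne c.D 0)).CompatibleSplitting)
  (hGR₃ : ∀ {L : CMField} {ι₁ : L →+* ℂ} (V : HermSpace3 L ι₁) (c : SeesawCtx L),
    (cmSplittingDatum (L : Type) (e₁) (frameD V) (frameD_real V) (frameD_ne V) (lineVec (L : Type) (dW' c.D 1))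
      (fun _ => dW'_real c.D 1) (fun _ => dW'_ne c.D 1)).CompatibleSplitting)

/-- **the generic-`μ` pin R2 at equal slot tables is the same pin**, whatever (J-μ) proof inputs are supplied on either side
(`subst` + proof irrelevance). -/
theorem SROGT'C_congr_μ {m m' : ∀ {L : CMField}, SeesawCtx L → Fin 4 → NumberField.InfinitePlace (L : Type) → ℤ}
    (e : @m = @m') (p₁ p₂ p₃ q₁ q₂ q₃) {L : CMField} {ι₁ : L →+* ℂ} (V : HermSpace3 L ι₁) (c : SeesawCtx L) :
    SROGT'C @hGR @hGR₀ @hGR₁ @hGR₂ @hGR₃ @m p₁ p₂ p₃ V c = SROGT'C @hGR @hGR₀ @hGR₁ @hGR₂ @hGR₃ @m' q₁ q₂ q₃ V c := by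
  subst e
  rfl

/-- **THE PIN R2 WITH NO PROVE INPUT READS `μ` ONLY AT SLOT 0**: slot tables with the same slot-0 entries give the SAME pin
`SROGT'CJ` (glue-1's (O2) reading, as a theorem). -/
theorem SROGT'CJ_congr_slot0 {μ μ' : ∀ {L : CMField}, SeesawCtx L → Fin 4 → NumberField.InfinitePlace (L : Type) → ℤ}
    (h : ∀ {L : CMField} (c : SeesawCtx L), μ c 0 = μ' c 0) {L : CMField} {ι₁ : L →+* ℂ} (V : HermSpace3 L ι₁) (c : SeesawCtx L) :
    SROGT'CJ @hGR @hGR₀ @hGR₁ @hGR₂ @hGR₃ @μ V c = SROGT'CJ @hGR @hGR₀ @hGR₁ @hGR₂ @hGR₃ @μ' V c :=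
  SROGT'C_congr_μ @hGR @hGR₀ @hGR₁ @hGR₂ @hGR₃ (ArchSideTerm.muSharp₂₃_congr_slot0 h) _ _ _ _ _ _ V c

end SInstance

end HodgeCM.Model

end
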